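/-
COR-CM (cell pub-hodgecm2, stage 2 of the Hodge ladder) — DELREC (PLANNER-D «Deligne record → printed constituents», row ii-d, planner HOME/INBOX
l.14865; seat prover-pub-hodgecm2-delrec-p4-g0-0).  THE CONVERSE + KERNEL EQUIVALENCE for the «form» display: the tree's packaged Deligne record
`UnitaryCanonicalModel.exists_recordSystem` (the binder `h` of the ENDs) and [Deligne 1979] 2.2.5 + Cor. 2.7.21 read LITERALLY as «a form of
`M_ℂ(G,X)` over `E(G,X) = τ(L)` with the reciprocity law at the special points» (`UnitaryCanonicalModel.canonicalModel_exists_form`, row B1 ✔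
p375397) are EQUIVALENT in the kernel.  THEOREMS ONLY (two one-line compositions of landed rows: S1b′ `printed_of_exists_recordSystem` (`DelRec/PrintedOfRecordSystemLocal.lean`, ✔ p376924), B1
`canonicalModel_exists_printed_iff_form`, ii-a `exists_recordSystem_of_form`); nothing landed is edited or restated; new declaration names under
`Summit.HodgeConjecture.CorCM.DelRec`.  FRAMING: HC_CM is NOT proved; nothing here discharges any displayed hypothesis of any END — the citation is
re-shaped, not removed.
-/
import Summits.HodgeConjecture.CorCM.DelRec.PrintedOfRecordSystemLocal
import Summits.HodgeConjecture.CorCM.DelRec.RecordSystemOfForm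
import HarnessLib

/-!
# `exists_recordSystem ↔ canonicalModel_exists_form` — the Deligne record versus [Deligne 1979] 2.2.5 + Cor. 2.7.21 «form + (62)»

[Deligne1979ShimuraVarieties] 2.2.5 (PDF p. 29 L16–28 of Milne's translation): «A canonical model `M(G,X)` of `M_ℂ(G,X)` is a form over `E(G,X)` of
`M_ℂ(G,X)` … such that … (b) … the Galois group … acts through the action 2.2.4.  By "form" we mean a scheme `M` over `E(G,X)` equipped with … an
equivariant isomorphism `M ⊗_{E(G,X)} ℂ ⥲ M_ℂ(G,X)`»; Cor. 2.7.21 (PDF p. 52): canonical models exist.  Row B1 types exactly this at the datum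
`(Res_{L⁺/ℚ} U(H), 𝔹²)` of [Liu2021] App. C as `canonicalModel_exists_form`: for EVERY complex record system `Sc` (= `M_ℂ(G,X)`, 2.1.2) there are
`L`-schemes `M_K` functorial in `K ≤ K₀`, an `L`-form `e : M ⊗_{L,τ} ℂ ≅ Sc.Mc`, and reciprocity (62) at the diagonal special pairs — NO smoothness ∕
projectivity clause (those DESCEND along `τ : L → ℂ`: B1's `smoothOfRelativeDimension_of_form`, `isProjectiveOver_of_form`, from Mathlib's fpqc
descent of `Smooth`, the tree's `HodgeTheory.smoothOfRelativeDimension_hom_of_baseChangeHom` and `Motives.IsProjectiveOver.of_baseChange_holds` =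
[GortzWedhorn2020] Prop. 14.57).

Main results (namespace `Summit.HodgeConjecture.CorCM.DelRec`):

* **`form_of_exists_recordSystem : exists_recordSystem → canonicalModel_exists_form`** — row S1b's `printed_of_exists_recordSystem` (a record system
  is a canonical descent of its own complex shadow, transported to ANY complex record system along row S0's `pts`-compatible isomorphism,
  [Del79] 2.1.2 «unique [Borel]»), then forget the two descended clauses (row B1's `canonicalModel_exists_printed_iff_form`, `→`);
* **`exists_recordSystem_iff_form : exists_recordSystem ↔ canonicalModel_exists_form`** — with row ii-a's `exists_recordSystem_of_form` (`←`):
  THE KERNEL EQUIVALENCE behind the «form» display edition (row ii-c): an END displaying `hDel' : canonicalModel_exists_form` in place of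
  `h : exists_recordSystem` changes the SHAPE of the displayed citation, not the trust base; every verdict on either END transfers verbatim.
* `printed_iff_form_of_record` — bookkeeping: the three readings `exists_recordSystem`, `canonicalModel_exists_printed` (row L1) and
  `canonicalModel_exists_form` (row B1) are pairwise equivalent (S1b's `exists_recordSystem_iff_printed`, B1's iff, this file's iff), stated once
  as a conjunction for the packet.

0 hypothesis binders of Prop-valued named facts beyond the displayed endpoints (T5: n/a).  HC_CM is NOT proved; neither side of any `↔` is asserted.

## References
* [Deligne1979ShimuraVarieties] P. Deligne, *Variétés de Shimura: interprétation modulaire, et techniques de construction de modèles canoniques*,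
  PSPM XXXIII.2 (1979): 2.1.2–2.1.4 (PDF p. 24), 2.2.4–2.2.5 (PDF p. 29), Cor. 2.7.21 (PDF p. 52) of Milne's translation `paper:url-7710442a1cf6`.
* [Milne2005ShimuraVarieties] J. S. Milne, *Introduction to Shimura varieties* (2005/2017, `paper:url-b0e8e4ca1c12`): Thm. 3.14 p. 39, Cor. 3.16 p. 40,
  Def. 12.8 (62) p. 114, Def. 12.10 p. 115.
* [GortzWedhorn2020] U. Görtz, T. Wedhorn, *Algebraic Geometry I* (2nd ed. 2020), Prop. 14.57 (p. 571).
* [Liu2021] Y. Liu, *Fourier–Jacobi cycles and arithmetic relative trace formula*, Camb. J. Math. 9 (2021), App. C §C.1 and Rem. C.2.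
-/

set_option autoImplicit false

namespace Summit.HodgeConjecture.CorCM.DelRec

open Literature.AlgebraicGeometry.ShimuraVarieties.UnitaryCanonicalModel

/-- **Deligne's record system GIVES [Deligne 1979, 2.2.5 + Cor. 2.7.21] read as «a form of `M_ℂ(G,X)` over `τ(L)` with (62)»**
(`exists_recordSystem → canonicalModel_exists_form`): row S1b's `printed_of_exists_recordSystem` (the record system descends its own complex shadow,
`RecordSystem.descent_self`, and the descent transports to ANY complex record system along row S0's system-level `pts`-compatible isomorphism
`ComplexRecordSystem.nonempty_isoOfPts` — [Deligne1979ShimuraVarieties] 2.1.2 «unique [Borel]»), then FORGET the smoothness ∕ projectivity clauses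
(row B1's `canonicalModel_exists_printed_iff_form`, direction `→`).  HC_CM is NOT proved; `exists_recordSystem` is a hypothesis here, not asserted.
[cite: Deligne1979ShimuraVarieties, 2.1.2, 2.2.5 and Cor. 2.7.21 (PDF pp. 24, 29, 52 of Milne's translation)]
[cite: Milne2005ShimuraVarieties, Def. 12.8 (62) p. 114; Thm. 3.14 p. 39 and Cor. 3.16 p. 40] -/
theorem form_of_exists_recordSystem (h : exists_recordSystem) : canonicalModel_exists_form :=
  canonicalModel_exists_printed_iff_form.mp (printed_of_exists_recordSystem h)

/-- **THE KERNEL EQUIVALENCE `exists_recordSystem ↔ canonicalModel_exists_form`.**  The PACKAGED Deligne record of the tree (7 fields, 4 of them tree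
theorems) and [Deligne1979ShimuraVarieties] 2.2.5 + Cor. 2.7.21 read LITERALLY at the datum `(Res_{L⁺/ℚ} U(H), 𝔹²)` — «`M_ℂ(G,X)` admits a form over
`E(G,X) = τ(L)` on which `Aut(ℂ/τL)` acts at the [diagonal] special points by the reciprocity law (62)», and NOTHING ELSE — have the same content:
`→` = `form_of_exists_recordSystem` (rows S0 + S1b + B1), `←` = row ii-a `exists_recordSystem_of_form` (rows B1 + S1a: smoothness and projectivity of
the `L`-models DESCEND from `M_ℂ` along `τ`, [GortzWedhorn2020] Prop. 14.57 and fpqc descent of smoothness, then `HComp.nonempty_complexRecordSystem` +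
`RecordSystem.nonempty_of_descent`).  Consequently an END displaying `hDel' : canonicalModel_exists_form` (row ii-c) and an END displaying
`h : exists_recordSystem` are interchangeable in the kernel; every verdict on one transfers verbatim to the other.  Neither side is asserted;
HC_CM is NOT proved.
[cite: Deligne1979ShimuraVarieties, 2.1.2–2.1.4, 2.2.5 and Cor. 2.7.21 (PDF pp. 24, 29, 52 of Milne's translation)]
[cite: Milne2005ShimuraVarieties, Def. 12.8 (62) p. 114; Def. 12.10 p. 115] [cite: GortzWedhorn2020, Prop. 14.57 (p. 571)] -/
theorem exists_recordSystem_iff_form : exists_recordSystem ↔ canonicalModel_exists_form :=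
  ⟨form_of_exists_recordSystem, exists_recordSystem_of_form⟩

/-- **The three readings of the Deligne citation are pairwise equivalent in the kernel** (bookkeeping for the packet): the packaged record
`exists_recordSystem` (displayed as `h` by the END editions of record), the printed existential WITH the [Liu2021] §C.1 smooth ∕ projective rider
`canonicalModel_exists_printed` (row L1, displayed as `hDel` by rows S2 ∕ S3), and the bare «form + (62)» reading `canonicalModel_exists_form`
(row B1, displayed as `hDel'` by row ii-c): `exists_recordSystem ↔ canonicalModel_exists_printed` (row S1b), `canonicalModel_exists_printed ↔
canonicalModel_exists_form` (row B1), `exists_recordSystem ↔ canonicalModel_exists_form` (this file).  Nothing is asserted; HC_CM is NOT proved.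
[cite: Deligne1979ShimuraVarieties, 2.2.5 and Cor. 2.7.21 (PDF pp. 29, 52 of Milne's translation)] [cite: Liu2021, App. C §C.1 and Rem. C.2] -/
theorem printed_iff_form_of_record :
    (exists_recordSystem ↔ canonicalModel_exists_printed) ∧ (canonicalModel_exists_printed ↔ canonicalModel_exists_form) ∧
      (exists_recordSystem ↔ canonicalModel_exists_form) :=
  ⟨exists_recordSystem_iff_printed, canonicalModel_exists_printed_iff_form, exists_recordSystem_iff_form⟩

end Summit.HodgeConjecture.CorCM.DelRec
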